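import Literature.AlgebraicGeometry.HodgeTheory.DworkSexticPencilFamily
import Literature.AlgebraicGeometry.HodgeTheory.DworkSexticEigenspaces
import Literature.AlgebraicGeometry.HodgeTheory.DworkSexticJacobianInvariantLineInjective
import Literature.AlgebraicGeometry.HodgeTheory.HodgeFiltration
import Literature.AlgebraicGeometry.HodgeTheory.IsoTransport
import Literature.AlgebraicGeometry.HodgeTheory.HypersurfaceLefschetzProofs
import Literature.AlgebraicGeometry.HodgeTheory.AlgebraicClassesHodgeTypeHolds
import Literature.AlgebraicGeometry.HodgeTheory.SupportedClassesHodgeConiveauProofs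
import Literature.AlgebraicGeometry.HodgeTheory.HodgeTypeConjugation
import Literature.AlgebraicGeometry.HodgeTheory.RationalClassesRingChange
import Literature.AlgebraicGeometry.HodgeTheory.RationalLattice
import Literature.AlgebraicGeometry.HodgeTheory.HyperplaneSectionMonodromyProofs
import Literature.AlgebraicGeometry.HodgeTheory.SpecialisationMapComplexPoints
import Mathlib.LinearAlgebra.Countable
import HarnessLib

/-!
# Route `DworkReflectionQuotients`, crux `GenericInvariantHodgeClasses` (GI): preliminaries

Route `route-HodgeConjecture-DworkReflectionQuotients` (cell `hodge-nonav`; FRONTIER rung F-H1 — never summit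
credit), item `stmt-HodgeConjecture-24129` `GenericInvariantHodgeClasses`. Prover seat `hodge-nonav-20241-p1`
(g9). SUPPORT FILE: lemmas for the Noether–Lefschetz assembly of the sequel
`DworkReflectionQuotientsGIOfAnalyticInputs`:

* §1 general lemmas — the isolated points of any subset of a second-countable space form a countable set
  (the one-dimensional source of countability: an analytic locus on a curve is a neighbourhood or discrete);
  the rational classes of `Hᵏ(X(ℂ); ℂ)` of a smooth projective `X` are countable; a class of Hodge type
  `(p, q)` lying in `Fʳ`, `r > p`, vanishes;
* §2 for the Dwork pencil `π : 𝒳 → D` (`DworkSextic.pencil`): invariance under the realised diagonal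
  symmetries `a ∈ μ₆⁶`, `∏ aᵢ = 1`, transfers from `X_ψ` to the fibre `𝒳_{[F_ψ]}` along a fibre
  isomorphism compatible with the embeddings into `ℙ⁵` (`dworkPencil_invariant_of_iso`).

Nothing here says HC, HC_CM or HC_AV is proved; rung F-H1 not moved.

## References

* C. Voisin, *Hodge Theory and Complex Algebraic Geometry II* (2003), §5.3.1–§5.3.2. [VoisinHodgeII2003]
* C. Voisin, *Hodge Theory and Complex Algebraic Geometry I* (2002), §7.1.1, §9.2.1. [VoisinHodgeI2002]
* N. M. Katz, *Another look at the Dwork family*, Progr. Math. 270 (2009), §3. [Katz2009]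
-/

namespace Summit.HodgeConjecture.HodgeConjecture.Theorems

open CategoryTheory AlgebraicGeometry
open _root_.Topology _root_.Filter
open Literature.AlgebraicGeometry.HodgeTheory Literature.AlgebraicGeometry.Motives
open Literature.AlgebraicGeometry.Motives.UniversalHypersurface
open Literature.AlgebraicGeometry.HodgeTheory.UniversalHypersurface
open Literature.AlgebraicTopology.SingularHomology
open scoped BigOperators
/-! ### §1 Three general lemmas -/

/-- **The isolated points of any subset of a second-countable space form a countable set**: each
isolated point `t ∈ L` has a basic open `b ∋ t` with `b ∩ L ⊆ {t}`, and `t ↦ b` is injective on them.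
(The one-dimensional source of countability in Noether–Lefschetz arguments: a locus which is nowhere a
neighbourhood is discrete on a curve.) [folklore] -/
theorem countable_setOf_mem_and_not_frequently {α : Type*} [TopologicalSpace α]
    [SecondCountableTopology α] (L : Set α) :
    {t | t ∈ L ∧ ¬ ∃ᶠ t' in 𝓝[≠] t, t' ∈ L}.Countable := by
  classical
  have hbasis := TopologicalSpace.isBasis_countableBasis α
  have hex : ∀ t ∈ {t | t ∈ L ∧ ¬ ∃ᶠ t' in 𝓝[≠] t, t' ∈ L},
      ∃ b ∈ TopologicalSpace.countableBasis α, t ∈ b ∧ ∀ t' ∈ b, t' ∈ L → t' = t := by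
    rintro t ⟨-, ht⟩
    have h1 : ∀ᶠ t' in 𝓝[≠] t, t' ∉ L := Filter.not_frequently.mp ht
    rw [eventually_nhdsWithin_iff] at h1
    obtain ⟨b, hb, htb, hbs⟩ := hbasis.mem_nhds_iff.mp h1
    refine ⟨b, hb, htb, fun t' ht' ht'L => ?_⟩
    by_contra hne
    exact hbs ht' (Set.mem_compl_singleton_iff.mpr hne) ht'L
  choose! f hf using hex
  refine Set.MapsTo.countable_of_injOn (f := f) (fun t ht => (hf t ht).1) (fun t ht s hs hts => ?_)
    (TopologicalSpace.countable_countableBasis α)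
  have hsb : s ∈ f t := hts ▸ (hf s hs).2.1
  exact ((hf t ht).2.2 s hsb hs.1).symm

/-- **The rational classes of `Hᵏ(X(ℂ); ℂ)` of a smooth projective `X` form a countable set**
(they are the image of the finite-dimensional `ℚ`-space `Hᵏ(X(ℂ); ℚ)`). [folklore] -/
theorem countable_setOf_isRationalClass_complexPoints {n : ℕ} {X : SchemeOver ℂ}
    (hX : IsSmoothProjective n X) (k : ℕ) :
    {c : complexBetti X k | IsRationalClass c}.Countable := by
  haveI := finite_singularCohomology_rat_complexPoints hX k
  haveI : Countable (singularCohomology ℚ ℚ (ComplexPoints X) k) :=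
    Finsupp.Countable.of_moduleFinite (R := ℚ)
  rw [setOf_isRationalClass_eq_range]
  exact Set.countable_range _

/-- **A class of Hodge type `(p, q)` lying in `Fʳ`, `r > p`, vanishes** (the pieces of the Hodge
decomposition are independent; read in one model by the tree's model independence).
[cite-free linear algebra on the tree's `HodgeModel.disjoint_hodgePQ_hodgeFiltration`] [folklore] -/
theorem eq_zero_of_isOfHodgeType_of_isInHodgeFiltration {n : ℕ} {X : SchemeOver ℂ}
    (hX : IsSmoothProjective n X) {k p q r : ℕ} (hpq : p + q = k) (hr : p < r) {c : complexBetti X k}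
    (hc : IsOfHodgeType n X k p q c) (hF : IsInHodgeFiltration n X k r c) : c = 0 := by
  obtain ⟨A, hA⟩ := hF
  have h0 : A.pullback k c = 0 :=
    Submodule.disjoint_def.mp (A.disjoint_hodgePQ_hodgeFiltration hpq hr) _ (hc.mem_hodgePQ hX A) hA
  exact A.pullback_injective k (by rw [h0, map_zero])

/-! ### §2 The Dwork pencil: transfer of `Γ_W`-invariance along the fibre isomorphisms -/

/-- The homogeneous-coordinate map of an embedded scheme is natural in the embedding:
`pt_{e ≫ ι}(y) = pt_ι(e y)`. [folklore] -/
theorem hypersurfacePoint_comp_apply {n : ℕ} {Y Y' : SchemeOver ℂ} (e : Y' ⟶ Y)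
    (ι : Y ⟶ Literature.AlgebraicGeometry.Motives.projectiveSpace (n + 1) ℂ) (y : ComplexPoints Y') :
    hypersurfacePoint (e ≫ ι) y = hypersurfacePoint ι (AlgPoints.map e y) := by
  unfold hypersurfacePoint
  rw [AlgPoints.map_comp_apply]

/-- **Invariance under the realised diagonal symmetries `a ∈ μ₆⁶`, `∏ aᵢ = 1`, transfers from `X_ψ` to the
fibre `𝒳_{[F_ψ]}` of the pencil** along a fibre isomorphism `e` compatible with the embeddings into `ℙ⁵`:
a continuous self-map `g` of `𝒳_t(ℂ)` realising `[y] ↦ [a·y]` in the coordinates of `𝒳_t → ℙ⁵` is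
conjugate by `e(ℂ)` to one of `X_ψ(ℂ)` realising the same substitution in the coordinates of
`X_ψ ↪ ℙ⁵`. [cite: Katz2009, §3] -/
theorem dworkPencil_invariant_of_iso {ψ : ℂ} {t : ComplexPoints (baseSpz ℂ 4 6 DworkSextic.pencilSpz)}
    (e : fiberOver DworkSextic.pencil t ≅ DworkSextic.fibre ψ)
    (he : e.hom ≫ SmoothHypersurface.hypersurfaceι (DworkSextic.form ψ) =
      DworkSextic.pencilFiberToProjectiveSpace t)
    {c : complexBetti (DworkSextic.fibre ψ) (2 * 2)}
    (hinv : ∀ a : Fin 6 → ℂ, (∀ i, a i ^ 6 = 1) → ∏ i, a i = 1 →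
      ∀ g : C(ComplexPoints (DworkSextic.fibre ψ), ComplexPoints (DworkSextic.fibre ψ)),
        (∀ x, ∃ s : ℂ, (DworkSextic.pt ψ (g x)).rep = s • (a * (DworkSextic.pt ψ x).rep)) →
        singularCohomology.map ℂ ℂ g (2 * 2) c = c) :
    ∀ a : Fin 6 → ℂ, (∀ i, a i ^ 6 = 1) → ∏ i, a i = 1 →
      ∀ g : C(ComplexPoints (fiberOver DworkSextic.pencil t), ComplexPoints (fiberOver DworkSextic.pencil t)),
        (∀ y, ∃ s : ℂ, (hypersurfacePoint (DworkSextic.pencilFiberToProjectiveSpace t) (g y)).rep =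
            s • (a * (hypersurfacePoint (DworkSextic.pencilFiberToProjectiveSpace t) y).rep)) →
        singularCohomology.map ℂ ℂ g (2 * 2) (complexBetti.map e.hom (2 * 2) c) =
          complexBetti.map e.hom (2 * 2) c := by
  intro a ha hap g hg
  -- the conjugate self-map of `X_ψ(ℂ)`
  let G : C(ComplexPoints (DworkSextic.fibre ψ), ComplexPoints (DworkSextic.fibre ψ)) :=
    (AlgPoints.mapContinuous (L := ℂ) e.hom).comp (g.comp (AlgPoints.mapContinuous (L := ℂ) e.inv))
  have hGapply : ∀ x, G x = AlgPoints.map e.hom (g (AlgPoints.map e.inv x)) := fun x => rfl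
  have hinvhom : ∀ x : ComplexPoints (DworkSextic.fibre ψ), AlgPoints.map e.hom (AlgPoints.map e.inv x) = x :=
    fun x => by rw [← AlgPoints.map_comp_apply, e.inv_hom_id, AlgPoints.map_id_apply]
  have hhominv : ∀ y : ComplexPoints (fiberOver DworkSextic.pencil t),
      AlgPoints.map e.inv (AlgPoints.map e.hom y) = y :=
    fun y => by rw [← AlgPoints.map_comp_apply, e.hom_inv_id, AlgPoints.map_id_apply]
  -- coordinates on the fibre are those of `X_ψ` after `e`
  have hpt : ∀ y, hypersurfacePoint (DworkSextic.pencilFiberToProjectiveSpace t) y =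
      DworkSextic.pt ψ (AlgPoints.map e.hom y) := fun y => by
    rw [← he, hypersurfacePoint_comp_apply]
  have hGreal : ∀ x, ∃ s : ℂ, (DworkSextic.pt ψ (G x)).rep = s • (a * (DworkSextic.pt ψ x).rep) := by
    intro x
    obtain ⟨s, hs⟩ := hg (AlgPoints.map e.inv x)
    refine ⟨s, ?_⟩
    rw [hGapply, ← hpt, hs, hpt, hinvhom]
  have hGc := hinv a ha hap G hGreal
  -- `e(ℂ) ∘ g = G ∘ e(ℂ)`, so `g^* e^* c = e^* G^* c = e^* c`
  have hcomm : (AlgPoints.mapContinuous (L := ℂ) e.hom).comp g =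
      G.comp (AlgPoints.mapContinuous (L := ℂ) e.hom) :=
    ContinuousMap.ext fun y => by
      rw [ContinuousMap.comp_apply, ContinuousMap.comp_apply, hGapply, AlgPoints.mapContinuous_apply,
        AlgPoints.mapContinuous_apply, hhominv]
  calc singularCohomology.map ℂ ℂ g (2 * 2) (complexBetti.map e.hom (2 * 2) c)
      = singularCohomology.map ℂ ℂ ((AlgPoints.mapContinuous (L := ℂ) e.hom).comp g) (2 * 2) c := by
        rw [singularCohomology.map_comp, ModuleCat.comp_apply]
    _ = singularCohomology.map ℂ ℂ (G.comp (AlgPoints.mapContinuous (L := ℂ) e.hom)) (2 * 2) c := by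
        rw [hcomm]
    _ = complexBetti.map e.hom (2 * 2) (singularCohomology.map ℂ ℂ G (2 * 2) c) := by
        rw [singularCohomology.map_comp, ModuleCat.comp_apply]
    _ = complexBetti.map e.hom (2 * 2) c := by rw [hGc]

end Summit.HodgeConjecture.HodgeConjecture.Theorems
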